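import Literature.Computability.Cryptography.ChenQuantumLWESecretIndependence
import Literature.Computability.Cryptography.ChenQuantumLWEChirpFourier

/-!
# Chen (2024), Step 9: the exact probability of eq. (41) — a CRT split, `Pr[(41)] = Pr[p₁ ∣ u₀]/Q`,
# and the unprocessed sample (`R3`: skip (9.e)–(9.g)) is uniform with `Pr[(41)] = 1/P`

REPRODUCTION of a WITHDRAWN preprint, formalised for the record — NOT a live algorithmic claim and NOT
progress on any summit: Yilei Chen, *Quantum Algorithms for Lattice Problems*, IACR ePrint 2024/555,
versions of April 2024, withdrawn by the author's note of 2024-04-18/19 ("Step 9 of the algorithm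
contains a bug, which I don't know how to fix … the quantum algorithm in Section 3 is not correct";
tree key `ChenQuantumLattice2024`; the tree key `Chen2024` is an unrelated paper).  HONEST FRAMING: the
value of this file is a handful of kernel-checked identities about the output law of Step 9 AS WRITTEN
— a precise negative result about a withdrawn algorithm, nothing more.

`ChenQuantumLWEBornRule` proved `Pr[(41)] ≤ 1/Q` on every branch of every processing `K` of register 0,
and `ChenQuantumLWESecretIndependence` expressed the whole output law through the public head weight
`headWeight D p₁ Q K u₀`.  This file closes the remaining gap between the inequality and the numbers of the
bundle's repair census (`REPAIR-CENSUS.md` rows R1, R3, previously toy computations only):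

* `Shape.eq41_cons_iff` — **eq. (41) splits by the Chinese remainder theorem** (`P = p₁Q`,
  `gcd(p₁, Q) = 1`, `p₁ ∣ b*[1..n]`): eq. (41) holds at `(u₀ | u′)` iff `p₁ ∣ u₀` AND
  `⟨b*[1..n], u′⟩ ≡ -u₀ (mod Q)`.  The first conjunct involves register 0 only, the second is the
  `mod Q` congruence whose fibres carry exactly `1/Q` of the weight (`ChenQuantumLWECountingLaw`).
* `Shape.weight_eq41_mul`, `Shape.prob_eq41_eq` — hence, for EVERY kernel `K` (with the Bezout
  hypothesis on `b*[1..n] mod Q`, true for Chen's `b*` of eq. (39)):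
  `Pr[(41)] = Pr[p₁ ∣ u₀] / Q`, and in public closed form (`Shape.prob_eq41_eq_public`)
  `Pr[(41)] = (Σ_{p₁ ∣ u₀} headWeight K u₀) / (Q · Σ_{u₀} headWeight K u₀)`.  So the bound `1/Q` of
  `ChenQuantumLWEBornRule.prob_eq41_le` is attained EXACTLY by those `K` whose register-0 outcome is always a
  multiple of `p₁` (`Shape.prob_eq41_eq_inv_iff`) — which is all that Chen's steps (9.e)–(9.g) could ever
  have contributed to eq. (41): they bear on `u₀ mod p₁` only, never on the `mod Q` half that Lemma 3.8
  needs with certainty.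
* `Shape.weight_qft_phi8f`, `Shape.prob_eq41_unprocessed` — census row **R3** ("skip (9.e)–(9.g)", i.e.
  `K = 1`, `Shape.processed_one`): the final sample `u` is then UNIFORM on `ℤ_N^{n+1}`
  (`|QFT φ8.f (u)|² = P` for every `u` — Part 2's flat-spectrum theorem `weight_qft_phi8bKet`, which holds
  for every slope and offset, applied to `b*`, `v*`), `headWeight 1 u₀ = p₁` for every `u₀`, and
  `Pr[(41)] = 1/P` exactly (`= (1/p₁)·(1/Q)`).

Not here: a model of Chen's specific (9.e) — it is the refuted, unperformable display
(`ChenQuantumLWEDisplayRefutation`), so "Chen's own `K`" does not exist as a unitary; every statement is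
therefore quantified over all kernels `K`, which covers any repair of (9.e)–(9.g) acting on register 0.
-/

namespace Literature.Computability.Cryptography.Chen2024

open scoped BigOperators

namespace Shape

variable (S : Shape)

/-! ### Eq. (41) splits modulo `p₁` and modulo `Q` -/

/-- `p₁ ∣ N` (`N = D²p₁Q`). [cite: ChenQuantumLattice2024, §3.5.9 p. 35] -/
theorem p₁_dvd_N : (S.p₁ : ℕ) ∣ S.N :=
  ⟨S.D * S.D * S.Q, by simp only [Shape.N, Shape.P, PNat.mul_coe]; ring⟩

/-- The integer behind eq. (41) at the outcome `(u₀ | u′)`: `u₀ + Σ_t b*_{t+1} u′_t`, with the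
representatives `ZMod.val ∈ [0, N)` exactly as in `Shape.eq41`. [cite: ChenQuantumLattice2024, eq. (41) p. 38] -/
def eq41Int (u₀ : ZMod S.N) (u' : Fin S.n → ZMod S.N) : ℤ :=
  (u₀.val : ℤ) + ∑ t : Fin S.n, S.bstar (Fin.succ t) * ((u' t).val : ℤ)

/-- Eq. (41) at `(u₀ | u′)` says `P ∣ eq41Int u₀ u′`. [cite: ChenQuantumLattice2024, eq. (41) p. 38] -/
theorem eq41_cons_iff_dvd (u₀ : ZMod S.N) (u' : Fin S.n → ZMod S.N) :
    S.eq41 (Fin.cons u₀ u') ↔ ((S.P : ℕ) : ℤ) ∣ S.eq41Int u₀ u' := by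
  unfold eq41 eq41Int
  simp only [Fin.cons_zero, Fin.cons_succ]
  exact ZMod.intCast_zmod_eq_zero_iff_dvd _ _

/-- Modulo `p₁`, eq. (41) only sees register 0: `p₁ ∣ eq41Int u₀ u′ ↔ p₁ ∣ u₀` (because
`p₁ ∣ b*[1..n]`, eq. (39)). [cite: ChenQuantumLattice2024, eq. (39) p. 36 and eq. (41) p. 38] -/
theorem p₁_dvd_eq41Int_iff (h : S.Admissible) (u₀ : ZMod S.N) (u' : Fin S.n → ZMod S.N) :
    ((S.p₁ : ℕ) : ℤ) ∣ S.eq41Int u₀ u' ↔ (S.p₁ : ℕ) ∣ u₀.val := by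
  unfold eq41Int
  rw [dvd_add_left (Finset.dvd_sum fun t _ =>
    dvd_mul_of_dvd_left (h.bstar_tail (Fin.succ t) (Fin.succ_ne_zero t)) _)]
  exact Int.natCast_dvd_natCast

/-- Modulo `Q`, eq. (41) is the congruence `⟨b*[1..n], u′⟩ ≡ -u₀ (mod Q)` on the tail residue of
`ChenQuantumLWECountingLaw`. [cite: ChenQuantumLattice2024, eq. (41) p. 38] -/
theorem Q_dvd_eq41Int_iff (u₀ : ZMod S.N) (u' : Fin S.n → ZMod S.N) :
    ((S.Q : ℕ) : ℤ) ∣ S.eq41Int u₀ u' ↔ S.tailResidue u' = -(((u₀.val : ℕ)) : ZMod S.Q) := by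
  rw [← ZMod.intCast_zmod_eq_zero_iff_dvd]
  unfold eq41Int tailResidue
  simp only [Int.cast_add, Int.cast_sum, Int.cast_mul, Int.cast_natCast]
  rw [add_eq_zero_iff_neg_eq, eq_comm]

/-- **Eq. (41) splits by CRT.**  For an admissible shape (`P = p₁Q`, `gcd(p₁,Q) = 1`, `p₁ ∣ b*[1..n]`):
eq. (41) holds at the outcome `(u₀ | u′)` iff `p₁ ∣ u₀` and `⟨b*[1..n], u′⟩ ≡ -u₀ (mod Q)`.  The first
conjunct is a property of register 0 alone (all that steps (9.e)–(9.g) act on); the second is the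
`mod Q = mod p′` congruence Lemma 3.8 needs. [cite: ChenQuantumLattice2024, eq. (39)–(41) pp. 36–38; Lemma 3.8 p. 38] -/
theorem eq41_cons_iff (h : S.Admissible) (u₀ : ZMod S.N) (u' : Fin S.n → ZMod S.N) :
    S.eq41 (Fin.cons u₀ u') ↔
      (S.p₁ : ℕ) ∣ u₀.val ∧ S.tailResidue u' = -(((u₀.val : ℕ)) : ZMod S.Q) := by
  rw [S.eq41_cons_iff_dvd, ← S.p₁_dvd_eq41Int_iff h, ← S.Q_dvd_eq41Int_iff]
  have hP : ((S.P : ℕ) : ℤ) = ((S.p₁ : ℕ) : ℤ) * ((S.Q : ℕ) : ℤ) := by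
    simp only [Shape.P, PNat.mul_coe, Nat.cast_mul]
  rw [hP]
  have hcop : IsCoprime ((S.p₁ : ℕ) : ℤ) ((S.Q : ℕ) : ℤ) := Nat.isCoprime_iff_coprime.mpr h.cop_pQ
  exact ⟨fun hd => ⟨(Dvd.intro _ rfl).trans hd, (Dvd.intro_left _ rfl).trans hd⟩,
    fun hd => hcop.mul_dvd hd.1 hd.2⟩

/-! ### `Pr[(41)] = Pr[p₁ ∣ u₀] / Q` for every processing `K` of register 0 -/

/-- **The weight of eq. (41), times `Q`, is the weight of `[p₁ ∣ u₀]`** — for every kernel `K` on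
register 0 of `|φ8.f⟩` followed by `QFT_{ℤ_N^{n+1}}` (Bezout hypothesis on `b*[1..n] mod Q`, true for Chen's
`b*` by eq. (39)).  Per `u₀` with `p₁ ∣ u₀` this is the exact `1/Q` law of the `mod Q` fibre `-u₀`
(`eq41_modQ_fraction`); per `u₀` with `p₁ ∤ u₀` both sides vanish.
[cite: ChenQuantumLattice2024, §3.5.9 pp. 36–38, eq. (41)] -/
theorem weight_eq41_mul (h : S.Admissible) [DecidablePred S.eq41] (K : ZMod S.N → ZMod S.N → ℂ)
    (w : Fin S.n → ℤ) (hw : ((∑ t, w t * S.bstar (Fin.succ t) : ℤ) : ZMod S.Q) = 1) :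
    (∑ u ∈ Finset.univ.filter S.eq41, ‖qft (S.processed K) u‖ ^ 2) * S.Q
      = ∑ u ∈ Finset.univ.filter (fun u : Fin (S.n + 1) → ZMod S.N => (S.p₁ : ℕ) ∣ (u 0).val),
          ‖qft (S.processed K) u‖ ^ 2 := by
  rw [Finset.sum_filter, Finset.sum_filter, S.sum_cons, S.sum_cons, Finset.sum_mul]
  refine Finset.sum_congr rfl fun u₀ _ => ?_
  by_cases hp : (S.p₁ : ℕ) ∣ u₀.val
  · simp only [Fin.cons_zero, hp, if_true]
    rw [← Finset.sum_filter]
    have hf : (Finset.univ.filter fun u' : Fin S.n → ZMod S.N => S.eq41 (Fin.cons u₀ u'))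
        = Finset.univ.filter fun u' : Fin S.n → ZMod S.N =>
            S.tailResidue u' = -(((u₀.val : ℕ)) : ZMod S.Q) :=
      Finset.filter_congr fun u' _ => by rw [S.eq41_cons_iff h]; exact and_iff_right hp
    rw [hf]
    simp_rw [S.qft_processed_cons K]
    exact S.eq41_modQ_fraction h (S.fourierKernel K) u₀ w hw _
  · have hn : ∀ u' : Fin S.n → ZMod S.N, ¬ S.eq41 (Fin.cons u₀ u') := fun u' h41 =>
      hp ((S.eq41_cons_iff h u₀ u').1 h41).1
    simp only [Fin.cons_zero, hn, hp, if_false, Finset.sum_const_zero, zero_mul]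

/-- The weight of an event that depends on register 0 only, in public closed form:
`Σ_{u : p(u₀)} |QFT(processed K φ8.f)(u)|² = Nⁿ · Q · Σ_{u₀ : p(u₀)} headWeight K u₀`.
[cite: ChenQuantumLattice2024, §3.5.9 pp. 36–38] -/
theorem weight_head_filter (h : S.Admissible) (K : ZMod S.N → ZMod S.N → ℂ) (p : ZMod S.N → Prop)
    [DecidablePred p] :
    ∑ u ∈ Finset.univ.filter (fun u : Fin (S.n + 1) → ZMod S.N => p (u 0)), ‖qft (S.processed K) u‖ ^ 2
      = ((S.N : ℕ) : ℝ) ^ S.n * S.Q * ∑ u₀ ∈ Finset.univ.filter p, headWeight S.D S.p₁ S.Q K u₀ := by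
  rw [Finset.sum_filter, S.sum_cons, Finset.sum_filter, Finset.mul_sum]
  refine Finset.sum_congr rfl fun u₀ _ => ?_
  simp only [Fin.cons_zero]
  split_ifs with hp
  · simp_rw [S.born_weight_eq h K u₀, Finset.sum_const, Finset.card_univ, Fintype.card_fun, ZMod.card,
      Fintype.card_fin, nsmul_eq_mul, Nat.cast_pow]
    ring
  · simp

/-- **`Pr[(41)] = Pr[p₁ ∣ u₀] / Q`** for every admissible shape (Bezout hypothesis on `b*[1..n] mod Q`)
and EVERY kernel `K` on register 0: the probability that the final measurement satisfies eq. (41) is the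
probability that register 0 lands on a multiple of `p₁`, divided by `Q`.  (Both sides are `0` on the
degenerate branch `processed K = 0`.)  Lemma 3.8 asserted probability `1`.
[cite: ChenQuantumLattice2024, Lemma 3.8 and eq. (41) p. 38] -/
theorem prob_eq41_eq (h : S.Admissible) [DecidablePred S.eq41] (K : ZMod S.N → ZMod S.N → ℂ)
    (w : Fin S.n → ℤ) (hw : ((∑ t, w t * S.bstar (Fin.succ t) : ℤ) : ZMod S.Q) = 1) :
    (∑ u ∈ Finset.univ.filter S.eq41, ‖qft (S.processed K) u‖ ^ 2) / ∑ u, ‖qft (S.processed K) u‖ ^ 2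
      = ((∑ u ∈ Finset.univ.filter (fun u : Fin (S.n + 1) → ZMod S.N => (S.p₁ : ℕ) ∣ (u 0).val),
            ‖qft (S.processed K) u‖ ^ 2) / ∑ u, ‖qft (S.processed K) u‖ ^ 2) / S.Q := by
  have hQ : ((S.Q : ℕ) : ℝ) ≠ 0 := by exact_mod_cast S.Q.ne_zero
  by_cases hT : ∑ u, ‖qft (S.processed K) u‖ ^ 2 = 0
  · rw [hT, div_zero, div_zero, zero_div]
  · rw [div_div, div_eq_div_iff hT (mul_ne_zero hT hQ), ← S.weight_eq41_mul h K w hw]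
    ring

/-- **`Pr[(41)]` in public closed form**: `(Σ_{p₁ ∣ u₀} headWeight K u₀) / (Q · Σ_{u₀} headWeight K u₀)`
— a number determined by `(D, p₁, Q)` and the processing `K`, the same for every LWE instance.
[cite: ChenQuantumLattice2024, §3.5.9 pp. 36–38, eq. (41)] -/
theorem prob_eq41_eq_public (h : S.Admissible) [DecidablePred S.eq41] (K : ZMod S.N → ZMod S.N → ℂ)
    (w : Fin S.n → ℤ) (hw : ((∑ t, w t * S.bstar (Fin.succ t) : ℤ) : ZMod S.Q) = 1) :
    (∑ u ∈ Finset.univ.filter S.eq41, ‖qft (S.processed K) u‖ ^ 2) / ∑ u, ‖qft (S.processed K) u‖ ^ 2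
      = (∑ u₀ ∈ Finset.univ.filter (fun u₀ : ZMod S.N => (S.p₁ : ℕ) ∣ u₀.val),
            headWeight S.D S.p₁ S.Q K u₀)
          / (S.Q * ∑ a, headWeight S.D S.p₁ S.Q K a) := by
  have hQ : ((S.Q : ℕ) : ℝ) ≠ 0 := by exact_mod_cast S.Q.ne_zero
  have hN : ((S.N : ℕ) : ℝ) ^ S.n ≠ 0 := pow_ne_zero _ (by exact_mod_cast S.N.ne_zero)
  have hA : (∑ u ∈ Finset.univ.filter S.eq41, ‖qft (S.processed K) u‖ ^ 2)
      = ((S.N : ℕ) : ℝ) ^ S.n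
          * ∑ u₀ ∈ Finset.univ.filter (fun u₀ : ZMod S.N => (S.p₁ : ℕ) ∣ u₀.val),
              headWeight S.D S.p₁ S.Q K u₀ := by
    have h1 := S.weight_eq41_mul h K w hw
    rw [S.weight_head_filter h K (fun x : ZMod S.N => (S.p₁ : ℕ) ∣ x.val)] at h1
    exact mul_right_cancel₀ hQ (h1.trans (by ring))
  rw [hA, S.born_weight_total h K,
    show ((S.N : ℕ) : ℝ) ^ S.n * S.Q * ∑ a, headWeight S.D S.p₁ S.Q K a
      = ((S.N : ℕ) : ℝ) ^ S.n * (S.Q * ∑ a, headWeight S.D S.p₁ S.Q K a) by ring]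
  exact mul_div_mul_left _ _ hN

/-- **The bound `1/Q` is attained exactly when register 0 is surely a multiple of `p₁`.**  On a
non-degenerate branch, `Pr[(41)] = 1/Q ↔ Pr[p₁ ∣ u₀] = 1`: the most ANY processing of register 0 (Chen's
(9.e)–(9.g) or a repair) can contribute to eq. (41) is its `mod p₁` half; the `mod Q = mod p′` half that
Lemma 3.8 needs stays at probability `1/Q`. [cite: ChenQuantumLattice2024, Lemma 3.8 and eq. (41) p. 38] -/
theorem prob_eq41_eq_inv_iff (h : S.Admissible) [DecidablePred S.eq41] (K : ZMod S.N → ZMod S.N → ℂ)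
    (w : Fin S.n → ℤ) (hw : ((∑ t, w t * S.bstar (Fin.succ t) : ℤ) : ZMod S.Q) = 1) :
    (∑ u ∈ Finset.univ.filter S.eq41, ‖qft (S.processed K) u‖ ^ 2) / ∑ u, ‖qft (S.processed K) u‖ ^ 2
        = 1 / S.Q
      ↔ (∑ u ∈ Finset.univ.filter (fun u : Fin (S.n + 1) → ZMod S.N => (S.p₁ : ℕ) ∣ (u 0).val),
            ‖qft (S.processed K) u‖ ^ 2) / ∑ u, ‖qft (S.processed K) u‖ ^ 2 = 1 := by
  have hQ : ((S.Q : ℕ) : ℝ) ≠ 0 := by exact_mod_cast S.Q.ne_zero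
  rw [S.prob_eq41_eq h K w hw, one_div, div_eq_iff hQ, inv_mul_cancel₀ hQ]

/-! ### Census row R3: no processing at all (`K = 1`) -/

/-- `|φ8.f⟩` is Part 2's `phi8bKet` at slope `b*` and offset `v*` (the two kets are the same chirped line).
[cite: ChenQuantumLattice2024, eq. (40) p. 36] -/
theorem phi8f_eq_phi8bKet : S.phi8f = phi8bKet S.n S.D S.p₁ S.Q S.bstar S.vstar := by
  rw [phi8f_eq_ket]
  exact phi8bLine_ket S.n S.D S.p₁ S.Q S.bstar S.vstar

/-- **R3 (skip (9.e)–(9.g)): the final sample is uniform.**  `|QFT φ8.f (u)|² = P` for EVERY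
`u ∈ ℤ_N^{n+1}` — the flat-spectrum theorem of `ChenQuantumLWEChirpFourier` (valid for every slope and
offset) at `b*`, `v*`: measuring `|φ8.f⟩` in the Fourier basis with no processing of register 0 returns a
uniformly random `u` (census row R3, previously a toy computation). [cite: ChenQuantumLattice2024, eq. (40) p. 36, §3.5.9 p. 37] -/
theorem weight_qft_phi8f (h : S.Admissible) (u : Fin (S.n + 1) → ZMod S.N) :
    ‖qft S.phi8f u‖ ^ 2 = (S.P : ℕ) := by
  rw [phi8f_eq_phi8bKet]
  exact weight_qft_phi8bKet S.n S.D S.p₁ S.Q S.bstar S.vstar h.odd_P u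

/-- For the identity kernel the public head weight is flat: `headWeight 1 u₀ = p₁` for every `u₀` (the
head Gauss sum modulo `p₁` has unit leading coefficient). [cite: ChenQuantumLattice2024, eq. (40) p. 36] -/
theorem headWeight_one (h : S.Admissible) (u₀ : ZMod S.N) :
    headWeight S.D S.p₁ S.Q (fun x y : ZMod S.N => if x = y then (1 : ℂ) else 0) u₀ = S.p₁ := by
  have hQ : ((S.Q : ℕ) : ℝ) ≠ 0 := by exact_mod_cast S.Q.ne_zero
  have e1 := S.born_weight_eq h (fun x y : ZMod S.N => if x = y then (1 : ℂ) else 0) u₀ (fun _ => 0)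
  rw [S.processed_one, S.weight_qft_phi8f h, Shape.P, PNat.mul_coe, Nat.cast_mul] at e1
  exact (mul_right_cancel₀ hQ e1).symm

/-- `#{u₀ ∈ ℤ_N : p₁ ∣ u₀} · p₁ = N`. [folklore] -/
theorem card_head_multiples :
    (Finset.univ.filter fun u₀ : ZMod S.N => (S.p₁ : ℕ) ∣ u₀.val).card * S.p₁ = S.N := by
  have key := card_fibre_mul (n := 1) (N := (S.N : ℕ)) (S.p₁ : ℕ) S.p₁_dvd_N (fun _ => 1) (fun _ => 1)
    (by simp) 0
  rw [pow_one] at key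
  have hform : ∀ u' : Fin 1 → ZMod S.N,
      linFormMod (S.p₁ : ℕ) S.p₁_dvd_N (fun _ => (1 : ℤ)) u' = 0 ↔ (S.p₁ : ℕ) ∣ (u' 0).val := by
    intro u'
    unfold linFormMod
    rw [Fin.sum_univ_one, Int.cast_one, one_mul, ZMod.castHom_apply, ZMod.cast_eq_val,
      ZMod.natCast_eq_zero_iff]
  have hcard : (Finset.univ.filter fun u₀ : ZMod S.N => (S.p₁ : ℕ) ∣ u₀.val).card
      = (Finset.univ.filter fun u' : Fin 1 → ZMod S.N =>
          linFormMod (S.p₁ : ℕ) S.p₁_dvd_N (fun _ => (1 : ℤ)) u' = 0).card := by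
    refine Finset.card_bij' (fun u₀ _ => fun _ : Fin 1 => u₀) (fun u' _ => u' 0) (fun u₀ hu₀ => ?_)
      (fun u' hu' => ?_) (fun u₀ _ => rfl) (fun u' _ => funext fun t => by rw [Fin.fin_one_eq_zero t])
    · simp only [Finset.mem_filter, Finset.mem_univ, true_and] at hu₀ ⊢
      exact (hform _).2 hu₀
    · simp only [Finset.mem_filter, Finset.mem_univ, true_and] at hu' ⊢
      exact (hform _).1 hu'
  rw [hcard]
  exact key

/-- **R3: with no processing of register 0, `Pr[(41)] = 1/P` exactly** (`= (1/p₁)·(1/Q)`: register 0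
is uniform, so `Pr[p₁ ∣ u₀] = 1/p₁`).  Census row R3 of the bundle, previously certified only on a toy
instance. [cite: ChenQuantumLattice2024, Lemma 3.8 and eq. (41) p. 38] -/
theorem prob_eq41_unprocessed (h : S.Admissible) [DecidablePred S.eq41]
    (w : Fin S.n → ℤ) (hw : ((∑ t, w t * S.bstar (Fin.succ t) : ℤ) : ZMod S.Q) = 1) :
    (∑ u ∈ Finset.univ.filter S.eq41, ‖qft S.phi8f u‖ ^ 2) / ∑ u, ‖qft S.phi8f u‖ ^ 2
      = 1 / (S.P : ℕ) := by
  rw [← S.processed_one, S.prob_eq41_eq_public h _ w hw]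
  simp_rw [S.headWeight_one h, Finset.sum_const, Finset.card_univ, ZMod.card, nsmul_eq_mul]
  have hp : ((S.p₁ : ℕ) : ℝ) ≠ 0 := by exact_mod_cast S.p₁.ne_zero
  have hc : (((Finset.univ.filter fun u₀ : ZMod S.N => (S.p₁ : ℕ) ∣ u₀.val).card : ℕ) : ℝ) * S.p₁
      = S.N := by exact_mod_cast S.card_head_multiples
  rw [div_eq_div_iff (mul_ne_zero (by exact_mod_cast S.Q.ne_zero)
      (mul_ne_zero (by exact_mod_cast S.N.ne_zero) hp)) (by exact_mod_cast S.P.ne_zero), one_mul,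
    Shape.P, PNat.mul_coe, Nat.cast_mul]
  have hN' : ((((S.D * S.D * (S.p₁ * S.Q) : ℕ+) : ℕ)) : ℝ) = ((S.N : ℕ) : ℝ) := rfl
  rw [hN', ← hc]
  ring

end Shape

end Literature.Computability.Cryptography.Chen2024
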